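import Literature.AlgebraicGeometry.Motives.FamiliesVHSTensorConstraints
import Literature.AlgebraicGeometry.Motives.FamiliesVHSIso
import Literature.AlgebraicGeometry.Motives.FamiliesVHSTensorPower
import HarnessLib

/-!
# The `⊗`-constraints of VHS data are isometric isomorphisms: the norm-bounded Hodge loci and the flat-transport Hodge loci of `D₁ ⊗ D₂` and `D₂ ⊗ D₁`,
# of `(D₁ ⊗ D₂) ⊗ D₃` and `D₁ ⊗ (D₂ ⊗ D₃)`, of `ℤ_S(j) ⊗ D` and `D(j)`, of `ℤ_S ⊗ D`, `D ⊗ ℤ_S` and `D` coincide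

Topic `Literature/AlgebraicGeometry/Motives` (namespace `Literature.AlgebraicGeometry.Motives.VHSData`), lane `lit-hodgefound` (seat `p08`, row g57-#9).
DEFINITIONS WITH BODIES (the isomorphisms `Iso.tensorComm`, `Iso.tensorAssoc`, `Iso.tateTensor`, `Iso.unitTensor`, `Iso.tensorUnit`, `Iso.tensorPow`,
packaging the mutually inverse morphisms of `Motives/FamiliesVHSTensorConstraints` and the functoriality of `Motives/FamiliesVHSTensorPower` in the
structure `VHSData.Iso` of `Motives/FamiliesVHSIso`) and THEOREMS: each constraint is an ISOMETRY for the polarizations (`Q₁ ⊗ Q₂` versus `Q₂ ⊗ Q₁`,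
etc.), hence identifies the Cattani–Deligne–Kaplan loci `hodgeLocusOfNormLe`, and identifies the flat-transport Hodge loci of corresponding classes.
No named fact, no instance, no notation (D-0026 net debt `0`).

PRINTED SOURCES.  P. Deligne, J. Milne, *Tannakian categories*, LNM 900 (1982), §1 Def. 1.1, Prop. 1.3 (the constraints are functorial isomorphisms)
and Ex. 2.31 (polarized Hodge structures).  P. Deligne, *Théorie de Hodge II*, 1.1.12, 2.1.13–2.1.14 (`⊗`, `H(n) = H ⊗ ℤ(n)`).  E. Cattani, P. Deligne,
A. Kaplan, *On the locus of Hodge classes*, J. AMS 8 (1995), §1, Thm 1.1 (the loci `S^{(K)} = {(s, u) : u ∈ V_ℤ,s Hodge, Q(u,u) ≤ K}`).  W. Schmid,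
*Variation of Hodge structure*, §2.  P. Deligne, *Équations différentielles à points singuliers réguliers*, LNM 163 (1970), I.1.

* §0 two private extension principles: a morphism out of `D₁ ⊗ D₂` (resp. `(D₁ ⊗ D₂) ⊗ D₃`) is an isometry as soon as it is one on pure tensors.
* §1 **`Iso.tensorComm D₁ D₂ : D₁ ⊗ D₂ ≅ (D₂ ⊗ D₁).cast`**, an isometry (`Q₂(x₂,y₂)·Q₁(x₁,y₁) = Q₁(x₁,y₁)·Q₂(x₂,y₂)`); `hodgeLocusOfNormLe_tensor_comm`;
  `setOf_exists_isHodgeAt_transport_tmul_comm`.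
* §2 **`Iso.tensorAssoc D₁ D₂ D₃`**, an isometry (associativity of the product of the three forms); `hodgeLocusOfNormLe_tensor_assoc`.
* §3 **`Iso.tateTensor j D : ℤ_S(j) ⊗ D ≅ D(j).cast`**, an isometry (`(r r')·Q(x,y)`); `hodgeLocusOfNormLe_tate_tensor` (`= D.hodgeLocusOfNormLe (p + j) K`);
  **`setOf_exists_isHodgeAt_transport_one_tmul`** (the flat-transport locus of `1 ⊗ u` in level `p` is that of `u` in level `p + j`).
* §4 **`Iso.unitTensor D`, `Iso.tensorUnit D`**, isometries; `hodgeLocusOfNormLe_unit_tensor ∕ _tensor_unit` (`= D.hodgeLocusOfNormLe p K`).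
* §5 **`Iso.tensorPow e m : D^{⊗m} ≅ D'^{⊗m}`** for an isomorphism `e : D ≅ D'`.

HONEST SCOPE: as for every `VHSData`, holomorphy ∕ transversality are not recorded.

## References

* [DeligneMilne1982Tannakian] P. Deligne, J. S. Milne, *Tannakian categories*, in LNM 900 (1982), §1 Def. 1.1, Prop. 1.3, Ex. 2.31.
* [DeligneHodgeII1971] P. Deligne, *Théorie de Hodge II*, Publ. Math. IHÉS 40 (1971), 1.1.12, 2.1.13–2.1.14.
* [CattaniDeligneKaplan1995] E. Cattani, P. Deligne, A. Kaplan, *On the locus of Hodge classes*, J. Amer. Math. Soc. 8 (1995), §1, Thm 1.1.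
* [Schmid1973] W. Schmid, *Variation of Hodge structure: the singularities of the period mapping*, Invent. Math. 22 (1973), §2.
* [Deligne1970] P. Deligne, *Équations différentielles à points singuliers réguliers*, LNM 163 (1970), I.1.
-/

noncomputable section

open CategoryTheory
open scoped TensorProduct

namespace Literature.AlgebraicGeometry.Motives

namespace VHSData

variable {S : Type} [TopologicalSpace S] {k k₁ k₂ k₃ : ℤ}

/-! ## §0 Isometry is checked on pure tensors -/

/-- A morphism out of `D₁ ⊗ D₂` is an isometry as soon as `Q'(φ(x₁ ⊗ x₂), φ(y₁ ⊗ y₂)) = (Q₁ ⊗ Q₂)(x₁ ⊗ x₂, y₁ ⊗ y₂)` (bilinearity). [folklore] -/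
private theorem isIsometry_of_forall_tmul {D₁ : VHSData S k₁} {D₂ : VHSData S k₂} {D' : VHSData S (k₁ + k₂)} (φ : Hom (D₁.tensor D₂) D')
    (h : ∀ (s : S) (x₁ y₁ : D₁.V.fiber s) (x₂ y₂ : D₂.V.fiber s),
      (D'.form s).form (φ.appRat s (x₁ ⊗ₜ[ℚ] x₂)) (φ.appRat s (y₁ ⊗ₜ[ℚ] y₂)) = ((D₁.tensor D₂).form s).form (x₁ ⊗ₜ[ℚ] x₂) (y₁ ⊗ₜ[ℚ] y₂)) :
    φ.IsIsometry := fun s x y => by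
  have key : (D'.form s).form.compl₁₂ (φ.appRat s) (φ.appRat s) = ((D₁.tensor D₂).form s).form :=
    TensorProduct.ext' fun x₁ x₂ => TensorProduct.ext' fun y₁ y₂ => h s x₁ y₁ x₂ y₂
  exact LinearMap.congr_fun (LinearMap.congr_fun key x) y

/-- A morphism out of `(D₁ ⊗ D₂) ⊗ D₃` is an isometry as soon as it is one on the `(x₁ ⊗ x₂) ⊗ x₃`. [folklore] -/
private theorem isIsometry_of_forall_tmul_tmul {D₁ : VHSData S k₁} {D₂ : VHSData S k₂} {D₃ : VHSData S k₃} {D' : VHSData S (k₁ + k₂ + k₃)}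
    (φ : Hom ((D₁.tensor D₂).tensor D₃) D')
    (h : ∀ (s : S) (x₁ y₁ : D₁.V.fiber s) (x₂ y₂ : D₂.V.fiber s) (x₃ y₃ : D₃.V.fiber s),
      (D'.form s).form (φ.appRat s ((x₁ ⊗ₜ[ℚ] x₂) ⊗ₜ[ℚ] x₃)) (φ.appRat s ((y₁ ⊗ₜ[ℚ] y₂) ⊗ₜ[ℚ] y₃)) =
        (((D₁.tensor D₂).tensor D₃).form s).form ((x₁ ⊗ₜ[ℚ] x₂) ⊗ₜ[ℚ] x₃) ((y₁ ⊗ₜ[ℚ] y₂) ⊗ₜ[ℚ] y₃)) :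
    φ.IsIsometry := fun s x y => by
  have key : (D'.form s).form.compl₁₂ (φ.appRat s) (φ.appRat s) = (((D₁.tensor D₂).tensor D₃).form s).form :=
    TensorProduct.ext_threefold fun x₁ x₂ x₃ => TensorProduct.ext_threefold fun y₁ y₂ y₃ => h s x₁ y₁ x₂ y₂ x₃ y₃
  exact LinearMap.congr_fun (LinearMap.congr_fun key x) y

/-! ## §1 Commutativity -/

section Comm

variable (D₁ : VHSData S k₁) (D₂ : VHSData S k₂)

/-- **`D₁ ⊗ D₂ ≅ D₂ ⊗ D₁`** (the commutativity constraint and its inverse of `Motives/FamiliesVHSTensorConstraints`, packaged).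
[cite: DeligneMilne1982Tannakian, §1 Def. 1.1] [cite: Deligne1970, I.1] -/
def Iso.tensorComm : Iso (D₁.tensor D₂) ((D₂.tensor D₁).cast (add_comm k₂ k₁)) where
  hom := Hom.tensorComm D₁ D₂
  inv := Hom.tensorCommSymm D₁ D₂
  inv_comp_hom := Hom.tensorCommSymm_comp_tensorComm D₁ D₂
  hom_comp_inv := Hom.tensorComm_comp_tensorCommSymm D₁ D₂

/-- `(Iso.tensorComm).hom = Hom.tensorComm`. [cite: Deligne1970, I.1] -/
@[simp] theorem Iso.tensorComm_hom : (Iso.tensorComm D₁ D₂).hom = Hom.tensorComm D₁ D₂ := rfl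

/-- `(Iso.tensorComm).inv = Hom.tensorCommSymm`. [cite: Deligne1970, I.1] -/
@[simp] theorem Iso.tensorComm_inv : (Iso.tensorComm D₁ D₂).inv = Hom.tensorCommSymm D₁ D₂ := rfl

/-- The rationalization of the commutativity constraint on a pure tensor: `x₁ ⊗ x₂ ↦ x₂ ⊗ x₁`. [cite: Deligne1970, I.1] -/
theorem Hom.appRat_tensorComm_tmul (s : S) (x₁ : D₁.V.fiber s) (x₂ : D₂.V.fiber s) :
    (Hom.tensorComm D₁ D₂).appRat s (x₁ ⊗ₜ[ℚ] x₂) = x₂ ⊗ₜ[ℚ] x₁ :=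
  LinearMap.congr_fun (homRat_tensorComm D₁ D₂ s) (x₁ ⊗ₜ[ℚ] x₂)

/-- **The commutativity constraint is an isometry**: `(Q₂ ⊗ Q₁)(x₂ ⊗ x₁, y₂ ⊗ y₁) = Q₂(x₂,y₂) Q₁(x₁,y₁) = (Q₁ ⊗ Q₂)(x₁ ⊗ x₂, y₁ ⊗ y₂)`.
[cite: DeligneMilne1982Tannakian, §1 Def. 1.1 and Ex. 2.31] -/
theorem Iso.isIsometry_tensorComm_hom : (Iso.tensorComm D₁ D₂).hom.IsIsometry :=
  isIsometry_of_forall_tmul (Hom.tensorComm D₁ D₂) fun s x₁ y₁ x₂ y₂ => by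
    rw [Hom.appRat_tensorComm_tmul, Hom.appRat_tensorComm_tmul]
    show ((D₂.tensor D₁).form s).form (x₂ ⊗ₜ[ℚ] x₁) (y₂ ⊗ₜ[ℚ] y₁) = ((D₁.tensor D₂).form s).form (x₁ ⊗ₜ[ℚ] x₂) (y₁ ⊗ₜ[ℚ] y₂)
    rw [tensor_form_form_tmul, tensor_form_form_tmul, mul_comm]

/-- **The norm-bounded Hodge loci of `D₁ ⊗ D₂` and `D₂ ⊗ D₁` coincide.** [cite: CattaniDeligneKaplan1995, §1, Thm 1.1] -/
theorem hodgeLocusOfNormLe_tensor_comm (p K : ℤ) : (D₁.tensor D₂).hodgeLocusOfNormLe p K = (D₂.tensor D₁).hodgeLocusOfNormLe p K :=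
  (Iso.tensorComm D₁ D₂).hodgeLocusOfNormLe_eq (Iso.isIsometry_tensorComm_hom D₁ D₂) p K

/-- **The flat-transport Hodge loci of `u₂ ⊗ u₁` and `u₁ ⊗ u₂` coincide.** [cite: CattaniDeligneKaplan1995, §1] -/
theorem setOf_exists_isHodgeAt_transport_tmul_comm (s : S) (p : ℤ) (u₁ : D₁.VZ.fiber s) (u₂ : D₂.VZ.fiber s) :
    {t | ∃ γ : Path.Homotopic.Quotient s t, (D₂.tensor D₁).IsHodgeAt t p ((D₂.tensor D₁).VZ.transport γ (u₂ ⊗ₜ[ℤ] u₁))} =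
      {t | ∃ γ : Path.Homotopic.Quotient s t, (D₁.tensor D₂).IsHodgeAt t p ((D₁.tensor D₂).VZ.transport γ (u₁ ⊗ₜ[ℤ] u₂))} :=
  (Iso.tensorComm D₁ D₂).setOf_exists_isHodgeAt_transport_eq s p (u₁ ⊗ₜ[ℤ] u₂)

end Comm

/-! ## §2 Associativity -/

section Assoc

variable (D₁ : VHSData S k₁) (D₂ : VHSData S k₂) (D₃ : VHSData S k₃)

/-- **`(D₁ ⊗ D₂) ⊗ D₃ ≅ D₁ ⊗ (D₂ ⊗ D₃)`** (the associativity constraint and its inverse, packaged). [cite: DeligneMilne1982Tannakian, §1 Def. 1.1] [cite: Deligne1970, I.1] -/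
def Iso.tensorAssoc : Iso ((D₁.tensor D₂).tensor D₃) ((D₁.tensor (D₂.tensor D₃)).cast (add_assoc k₁ k₂ k₃).symm) where
  hom := Hom.tensorAssoc D₁ D₂ D₃
  inv := Hom.tensorAssocSymm D₁ D₂ D₃
  inv_comp_hom := Hom.tensorAssocSymm_comp_tensorAssoc D₁ D₂ D₃
  hom_comp_inv := Hom.tensorAssoc_comp_tensorAssocSymm D₁ D₂ D₃

/-- `(Iso.tensorAssoc).hom = Hom.tensorAssoc`. [cite: Deligne1970, I.1] -/
@[simp] theorem Iso.tensorAssoc_hom : (Iso.tensorAssoc D₁ D₂ D₃).hom = Hom.tensorAssoc D₁ D₂ D₃ := rfl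

/-- The rationalization of the associativity constraint on `(x₁ ⊗ x₂) ⊗ x₃` is `x₁ ⊗ (x₂ ⊗ x₃)`. [cite: Deligne1970, I.1] -/
theorem Hom.appRat_tensorAssoc_tmul (s : S) (x₁ : D₁.V.fiber s) (x₂ : D₂.V.fiber s) (x₃ : D₃.V.fiber s) :
    (Hom.tensorAssoc D₁ D₂ D₃).appRat s ((x₁ ⊗ₜ[ℚ] x₂) ⊗ₜ[ℚ] x₃) = x₁ ⊗ₜ[ℚ] (x₂ ⊗ₜ[ℚ] x₃) :=
  LinearMap.congr_fun (homRat_tensorAssoc D₁ D₂ D₃ s) ((x₁ ⊗ₜ[ℚ] x₂) ⊗ₜ[ℚ] x₃)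

/-- **The associativity constraint is an isometry** (`Q₁(Q₂Q₃) = (Q₁Q₂)Q₃` on pure tensors). [cite: DeligneMilne1982Tannakian, §1 Def. 1.1 and Ex. 2.31] -/
theorem Iso.isIsometry_tensorAssoc_hom : (Iso.tensorAssoc D₁ D₂ D₃).hom.IsIsometry :=
  isIsometry_of_forall_tmul_tmul (Hom.tensorAssoc D₁ D₂ D₃) fun s x₁ y₁ x₂ y₂ x₃ y₃ => by
    rw [Hom.appRat_tensorAssoc_tmul, Hom.appRat_tensorAssoc_tmul]
    show ((D₁.tensor (D₂.tensor D₃)).form s).form (x₁ ⊗ₜ[ℚ] (x₂ ⊗ₜ[ℚ] x₃)) (y₁ ⊗ₜ[ℚ] (y₂ ⊗ₜ[ℚ] y₃)) =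
      (((D₁.tensor D₂).tensor D₃).form s).form ((x₁ ⊗ₜ[ℚ] x₂) ⊗ₜ[ℚ] x₃) ((y₁ ⊗ₜ[ℚ] y₂) ⊗ₜ[ℚ] y₃)
    rw [tensor_form_form_tmul, tensor_form_form_tmul, tensor_form_form_tmul, tensor_form_form_tmul]
    ring

/-- **The norm-bounded Hodge loci of `(D₁ ⊗ D₂) ⊗ D₃` and `D₁ ⊗ (D₂ ⊗ D₃)` coincide.** [cite: CattaniDeligneKaplan1995, §1, Thm 1.1] -/
theorem hodgeLocusOfNormLe_tensor_assoc (p K : ℤ) :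
    ((D₁.tensor D₂).tensor D₃).hodgeLocusOfNormLe p K = (D₁.tensor (D₂.tensor D₃)).hodgeLocusOfNormLe p K :=
  (Iso.tensorAssoc D₁ D₂ D₃).hodgeLocusOfNormLe_eq (Iso.isIsometry_tensorAssoc_hom D₁ D₂ D₃) p K

end Assoc

/-! ## §3 The Tate twist as a tensor product -/

section Tate

variable (j : ℤ) (D : VHSData S k)

/-- **`ℤ_S(j) ⊗ D ≅ D(j)`** (Hodge II 2.1.14, packaged). [cite: DeligneHodgeII1971, 2.1.13–2.1.14] [cite: Deligne1970, I.1] -/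
def Iso.tateTensor : Iso ((tate S j).tensor D) ((D.tateTwist j).cast (HodgeStructure.tateTensor_weight k j)) where
  hom := Hom.tateTensor j D
  inv := Hom.tateTensorSymm j D
  inv_comp_hom := Hom.tateTensorSymm_comp_tateTensor j D
  hom_comp_inv := Hom.tateTensor_comp_tateTensorSymm j D

/-- `(Iso.tateTensor).hom = Hom.tateTensor`. [cite: DeligneHodgeII1971, 2.1.14] -/
@[simp] theorem Iso.tateTensor_hom : (Iso.tateTensor j D).hom = Hom.tateTensor j D := rfl

/-- The rationalization of `ℤ_S(j) ⊗ D → D(j)` on `q ⊗ x` is `q · x`. [cite: DeligneHodgeII1971, 2.1.14] -/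
theorem Hom.appRat_tateTensor_tmul (s : S) (q : ℚ) (x : D.V.fiber s) : (Hom.tateTensor j D).appRat s (q ⊗ₜ[ℚ] x) = q • x :=
  LinearMap.congr_fun (homRat_tateTensor j D s) (q ⊗ₜ[ℚ] x)

/-- On lattices `ℤ_S(j) ⊗ D → D(j)` sends `1 ⊗ u` to `u`. [cite: DeligneHodgeII1971, 2.1.14] -/
theorem Hom.tateTensor_app_one_tmul (s : S) (u : D.VZ.fiber s) : (Hom.tateTensor j D).app s ((1 : ℤ) ⊗ₜ[ℤ] u) = u :=
  LocalSystem.unitTensorMap_unitTensorInvMap D.VZ s u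

/-- **`ℤ_S(j) ⊗ D ≅ D(j)` is an isometry**: `Q_{ℤ(j)⊗D}(q ⊗ x, q' ⊗ y) = (q q') Q(x, y) = Q_{D(j)}(q x, q' y)` (the form of `D(j)` is that of `D`).
[cite: DeligneMilne1982Tannakian, §1, Ex. 2.31] [cite: DeligneHodgeII1971, 2.1.14] -/
theorem Iso.isIsometry_tateTensor_hom : (Iso.tateTensor j D).hom.IsIsometry :=
  isIsometry_of_forall_tmul (Hom.tateTensor j D) fun s r r' x y => by
    obtain ⟨q, rfl⟩ : ∃ q : ℚ, q = r := ⟨r, rfl⟩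
    obtain ⟨q', rfl⟩ : ∃ q' : ℚ, q' = r' := ⟨r', rfl⟩
    refine (congrArg₂ (fun a b => (((D.tateTwist j).cast (HodgeStructure.tateTensor_weight k j)).form s).form a b)
      (Hom.appRat_tateTensor_tmul j D s q x) (Hom.appRat_tateTensor_tmul j D s q' y)).trans ?_
    show (D.form s).form (q • x) (q' • y) = _
    rw [tensor_form_form_tmul, tate_form_form]
    simp only [map_smul, LinearMap.smul_apply, smul_eq_mul]
    ring

/-- **The norm-bounded Hodge locus of `ℤ_S(j) ⊗ D` in level `p` is that of `D` in level `p + j`.** [cite: CattaniDeligneKaplan1995, §1, Thm 1.1]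
[cite: DeligneHodgeII1971, 2.1.14] -/
theorem hodgeLocusOfNormLe_tate_tensor (p K : ℤ) : ((tate S j).tensor D).hodgeLocusOfNormLe p K = D.hodgeLocusOfNormLe (p + j) K :=
  ((Iso.tateTensor j D).hodgeLocusOfNormLe_eq (Iso.isIsometry_tateTensor_hom j D) p K).trans (D.hodgeLocusOfNormLe_tateTwist j p K)

/-- **The flat-transport Hodge locus of `1 ⊗ u ∈ ℤ(j) ⊗ V_ℤ,s` in level `p` is that of `u` in level `p + j`.** [cite: CattaniDeligneKaplan1995, §1]
[cite: DeligneHodgeII1971, 2.1.14] -/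
theorem setOf_exists_isHodgeAt_transport_one_tmul (s : S) (p : ℤ) (u : D.VZ.fiber s) :
    {t | ∃ γ : Path.Homotopic.Quotient s t, ((tate S j).tensor D).IsHodgeAt t p (((tate S j).tensor D).VZ.transport γ ((1 : ℤ) ⊗ₜ[ℤ] u))} =
      {t | ∃ γ : Path.Homotopic.Quotient s t, D.IsHodgeAt t (p + j) (D.VZ.transport γ u)} := by
  rw [← (Iso.tateTensor j D).setOf_exists_isHodgeAt_transport_eq s p ((1 : ℤ) ⊗ₜ[ℤ] u)]
  refine Set.ext fun t => exists_congr fun γ => ?_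
  rw [Iso.tateTensor_hom, Hom.tateTensor_app_one_tmul]
  exact ((D.tateTwist j).isHodgeAt_cast_iff (HodgeStructure.tateTensor_weight k j) t p _).trans (D.isHodgeAt_tateTwist_transport_iff j γ p u)

end Tate

/-! ## §4 The unitors -/

section Unit

variable (D : VHSData S k)

/-- **`ℤ_S ⊗ D ≅ D`** (left unitor, packaged). [cite: DeligneMilne1982Tannakian, §1 Prop. 1.3] [cite: Deligne1970, I.1] -/
def Iso.unitTensor : Iso ((unit S).tensor D) (D.cast (zero_add k).symm) where
  hom := Hom.unitTensor D
  inv := Hom.unitTensorSymm D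
  inv_comp_hom := Hom.unitTensorSymm_comp_unitTensor D
  hom_comp_inv := Hom.unitTensor_comp_unitTensorSymm D

/-- **`D ⊗ ℤ_S ≅ D`** (right unitor, packaged). [cite: DeligneMilne1982Tannakian, §1 Prop. 1.3] [cite: Deligne1970, I.1] -/
def Iso.tensorUnit : Iso (D.tensor (unit S)) (D.cast (add_zero k).symm) where
  hom := Hom.tensorUnit D
  inv := Hom.tensorUnitSymm D
  inv_comp_hom := Hom.tensorUnitSymm_comp_tensorUnit D
  hom_comp_inv := Hom.tensorUnit_comp_tensorUnitSymm D

/-- `(Iso.unitTensor).hom = Hom.unitTensor`. [cite: Deligne1970, I.1] -/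
@[simp] theorem Iso.unitTensor_hom : (Iso.unitTensor D).hom = Hom.unitTensor D := rfl

/-- `(Iso.tensorUnit).hom = Hom.tensorUnit`. [cite: Deligne1970, I.1] -/
@[simp] theorem Iso.tensorUnit_hom : (Iso.tensorUnit D).hom = Hom.tensorUnit D := rfl

/-- The rationalization of the left unitor on `q ⊗ x` is `q · x`. [cite: Deligne1970, I.1] -/
theorem Hom.appRat_unitTensor_tmul (s : S) (q : ℚ) (x : D.V.fiber s) : (Hom.unitTensor D).appRat s (q ⊗ₜ[ℚ] x) = q • x :=
  LinearMap.congr_fun (homRat_unitTensor D s) (q ⊗ₜ[ℚ] x)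

/-- The rationalization of the right unitor on `x ⊗ q` is `q · x`. [cite: Deligne1970, I.1] -/
theorem Hom.appRat_tensorUnit_tmul (s : S) (x : D.V.fiber s) (q : ℚ) : (Hom.tensorUnit D).appRat s (x ⊗ₜ[ℚ] q) = q • x :=
  LinearMap.congr_fun (homRat_tensorUnit D s) (x ⊗ₜ[ℚ] q)

/-- **The left unitor is an isometry.** [cite: DeligneMilne1982Tannakian, §1 Prop. 1.3 and Ex. 2.31] -/
theorem Iso.isIsometry_unitTensor_hom : (Iso.unitTensor D).hom.IsIsometry :=
  isIsometry_of_forall_tmul (Hom.unitTensor D) fun s r r' x y => by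
    obtain ⟨q, rfl⟩ : ∃ q : ℚ, q = r := ⟨r, rfl⟩
    obtain ⟨q', rfl⟩ : ∃ q' : ℚ, q' = r' := ⟨r', rfl⟩
    refine (congrArg₂ (fun a b => ((D.cast (zero_add k).symm).form s).form a b) (Hom.appRat_unitTensor_tmul D s q x)
      (Hom.appRat_unitTensor_tmul D s q' y)).trans ?_
    have hu : ((unit S).form s).form q q' = q * q' := rfl
    show (D.form s).form (q • x) (q' • y) = _
    rw [tensor_form_form_tmul, hu]
    simp only [map_smul, LinearMap.smul_apply, smul_eq_mul]
    ring

/-- **The right unitor is an isometry.** [cite: DeligneMilne1982Tannakian, §1 Prop. 1.3 and Ex. 2.31] -/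
theorem Iso.isIsometry_tensorUnit_hom : (Iso.tensorUnit D).hom.IsIsometry :=
  isIsometry_of_forall_tmul (Hom.tensorUnit D) fun s x y r r' => by
    obtain ⟨q, rfl⟩ : ∃ q : ℚ, q = r := ⟨r, rfl⟩
    obtain ⟨q', rfl⟩ : ∃ q' : ℚ, q' = r' := ⟨r', rfl⟩
    refine (congrArg₂ (fun a b => ((D.cast (add_zero k).symm).form s).form a b) (Hom.appRat_tensorUnit_tmul D s x q)
      (Hom.appRat_tensorUnit_tmul D s y q')).trans ?_
    have hu : ((unit S).form s).form q q' = q * q' := rfl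
    show (D.form s).form (q • x) (q' • y) = _
    rw [tensor_form_form_tmul, hu]
    simp only [map_smul, LinearMap.smul_apply, smul_eq_mul]
    ring

/-- **The norm-bounded Hodge locus of `ℤ_S ⊗ D` is that of `D`.** [cite: CattaniDeligneKaplan1995, §1, Thm 1.1] -/
theorem hodgeLocusOfNormLe_unit_tensor (p K : ℤ) : ((unit S).tensor D).hodgeLocusOfNormLe p K = D.hodgeLocusOfNormLe p K :=
  (Iso.unitTensor D).hodgeLocusOfNormLe_eq (Iso.isIsometry_unitTensor_hom D) p K

/-- **The norm-bounded Hodge locus of `D ⊗ ℤ_S` is that of `D`.** [cite: CattaniDeligneKaplan1995, §1, Thm 1.1] -/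
theorem hodgeLocusOfNormLe_tensor_unit (p K : ℤ) : (D.tensor (unit S)).hodgeLocusOfNormLe p K = D.hodgeLocusOfNormLe p K :=
  (Iso.tensorUnit D).hodgeLocusOfNormLe_eq (Iso.isIsometry_tensorUnit_hom D) p K

end Unit

/-! ## §5 Tensor powers of isomorphisms -/

/-- **`e^{⊗m} : D^{⊗m} ≅ D'^{⊗m}`** for an isomorphism `e : D ≅ D'` (functoriality `Hom.tensorPow_comp ∕ tensorPow_id` of `Motives/FamiliesVHSTensorPower`).
[cite: DeligneMilne1982Tannakian, §1, 1.5–1.6] -/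
def Iso.tensorPow {D D' : VHSData S k} (e : Iso D D') (m : ℕ) : Iso (D.tensorPow m) (D'.tensorPow m) where
  hom := Hom.tensorPow e.hom m
  inv := Hom.tensorPow e.inv m
  inv_comp_hom := by rw [← Hom.tensorPow_comp, e.inv_comp_hom, Hom.tensorPow_id]
  hom_comp_inv := by rw [← Hom.tensorPow_comp, e.hom_comp_inv, Hom.tensorPow_id]

/-- `(e^{⊗m}).hom = (e.hom)^{⊗m}`. [cite: DeligneMilne1982Tannakian, §1, 1.5–1.6] -/
@[simp] theorem Iso.tensorPow_hom {D D' : VHSData S k} (e : Iso D D') (m : ℕ) : (e.tensorPow m).hom = Hom.tensorPow e.hom m := rfl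

/-- Hence the flat-transport Hodge loci of `u^{⊗m}` and `(e u)^{⊗m}` coincide. [cite: CattaniDeligneKaplan1995, §1] -/
theorem Iso.setOf_exists_isHodgeAt_transport_tpow_eq {D D' : VHSData S k} (e : Iso D D') (m : ℕ) (s : S) (p : ℤ) (u : D.VZ.fiber s) :
    {t | ∃ γ : Path.Homotopic.Quotient s t, (D'.tensorPow m).IsHodgeAt t p ((D'.tensorPow m).VZ.transport γ (D'.tpow s m (e.hom.app s u)))} =
      {t | ∃ γ : Path.Homotopic.Quotient s t, (D.tensorPow m).IsHodgeAt t p ((D.tensorPow m).VZ.transport γ (D.tpow s m u))} := by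
  rw [← Hom.tensorPow_app_tpow]
  exact (e.tensorPow m).setOf_exists_isHodgeAt_transport_eq s p (D.tpow s m u)

end VHSData

end Literature.AlgebraicGeometry.Motives

end
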